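import Summits.QuantumFields.YangMills.Theorems.BalabanLadderROTWardEquiv
import Mathlib.Analysis.Calculus.BumpFunction.FiniteDimension
import Mathlib.Analysis.InnerProductSpace.Calculus
import HarnessLib

/-!
# Crux `ROT` (stmt-QuantumFields-20042), infinitesimal Ward route (lane B) — V: the shape witness, part 1 (profile and test function)

Helper file (`--supports stmt-QuantumFields-20042`, lane `ym-rot-20042-p2`).  Construction of the explicit objects used by the SHAPE
BARRIER `Theorems/BalabanLadderROTWardShape.lean` (does the hyperscaling binder's numerical content bound the angular insertion? —
no): one-particle angular calculus in the `(x₀,x₁)`-plane (`rotVec`, `angDeriv`; radial functions have `∂_θ = 0`, `∂_θ z⁰ = −z¹`,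
Leibniz), the smooth compactly supported profile `g(z) = η(‖z‖²) z⁰` with `h := ∂_θ g = −η(‖z‖²) z¹` (`|h| ≤ 2`, `h = 0` off the
ball of radius `2`, non-zero arbitrarily close to the origin), and for every scale `0 < s ≤ 1` the real test function
`f_s(w) = g(w₀−w₁) χ_s(w₀−w₁) ψ(w₁)` on `(ℝ⁴)²` (`χ_s` a radial annular cutoff at `‖z‖ ≈ s`, `ψ` a radial bump), its
complexification `F_s ∈ 𝓢((ℝ⁴)², ℂ)` (Mathlib `HasCompactSupport.toSchwartzMap`) and the membership
`F_s ∈ KingClass 2 r₀` for `2s < r₀` (off-diagonal, compact support, separation `s/2`, diameter `< 2s`).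

Pure Mathlib calculus; no statement about Yang–Mills.  No fact, no sorry.  Refs: Osterwalder–Schrader 1973 §4.2 (the rotation
generator on test functions); tree `Theorems/Y2BridgeKing.lean` (`King.KingClass`).
-/

set_option autoImplicit false

noncomputable section

open scoped SchwartzMap BigOperators RealInnerProductSpace ContDiff
open MeasureTheory Filter Topology Metric
open Literature.MathematicalPhysics.QuantumFieldTheory Literature.MathematicalPhysics.QuantumLattice
open Literature.MathematicalPhysics.AQFT
open Literature.Probability.LatticeModels (box Site mem_box)
open Summit.QuantumFields.YangMills.Cruxes.OSLegsFromFemtoAndGap.DlrCollarTransfer (MomentBounds)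
open Summit.QuantumFields.YangMills.Cruxes.OSLegsAtWeakCouplingC.Sketch (Separated SmallDiam)
open Summit.QuantumFields.YangMills.Cruxes.OSLegsAtWeakCouplingC.Y2Bridge (LatticeRotWard)
open Summit.QuantumFields.YangMills.Cruxes.OSLegsAtWeakCouplingC.Y2Bridge.King (KingClass)
open Summit.QuantumFields.YangMills.Theorems.OSLegsFromFemtoAndGap (torusMoment mul_norm_le_norm_smul_siteToE
  norm_smul_siteToE_sub_le abs_coord_le_norm_siteToE siteToE_sub)
open Summit.QuantumFields.YangMills.Theorems.NPointIsotropy.Negative (E4)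

namespace Summit.QuantumFields.YangMills.Theorems.ROT.Ward

/-! ## §1 One-particle angular calculus in the `(x₀,x₁)`-plane -/

/-- The generator of the rotations of the `(x₀,x₁)`-plane at the point `z ∈ ℝ⁴`: `z⁰ e₁ − z¹ e₀` (the per-slot field of
`LatticeRotWard`'s derivative `D F`). -/
def rotVec (z : E4) : E4 := (z 0) • (EuclideanSpace.single 1 1 : E4) - (z 1) • (EuclideanSpace.single 0 1 : E4)

/-- The rotation field of `LatticeRotWard` is `rotVec` slot by slot. -/
theorem rotField_eq_rotVec {n : ℕ} (x : Fin n → E4) :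
    (fun k => (x k 0) • (EuclideanSpace.single 1 1 : E4) - (x k 1) • (EuclideanSpace.single 0 1 : E4)) =
      fun k => rotVec (x k) := rfl

/-- `rotVec` is additive. -/
theorem rotVec_sub (z w : E4) : rotVec (z - w) = rotVec z - rotVec w := by
  simp only [rotVec, PiLp.sub_apply, sub_smul]
  abel

/-- The `0`-th coordinate of the generator: `(rotVec z)⁰ = −z¹`. -/
theorem rotVec_apply_zero (z : E4) : rotVec z 0 = -z 1 := by
  simp [rotVec]

/-- The generator is orthogonal to the position: `⟪z, rotVec z⟫ = 0`. -/
theorem inner_rotVec (z : E4) : ⟪z, rotVec z⟫ = 0 := by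
  simp only [rotVec, inner_sub_right, inner_smul_right, EuclideanSpace.inner_single_right]
  simp
  ring

/-- The angular derivative `∂_θ f (z) = df(z)·(rotVec z)` of a real function on `ℝ⁴`. -/
def angDeriv (f : E4 → ℝ) (z : E4) : ℝ := fderiv ℝ f z (rotVec z)

/-- **Radial functions have zero angular derivative**: `∂_θ (b ∘ ‖·‖²) = 0`. -/
theorem angDeriv_radial (b : ℝ → ℝ) (hb : Differentiable ℝ b) (z : E4) :
    angDeriv (fun z : E4 => b (‖z‖ ^ 2)) z = 0 := by
  unfold angDeriv
  have h1 : HasFDerivAt (fun z : E4 => ‖z‖ ^ 2) (2 • innerSL ℝ z) z := (hasStrictFDerivAt_norm_sq z).hasFDerivAt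
  have h2 : HasFDerivAt (fun z : E4 => b (‖z‖ ^ 2)) (deriv b (‖z‖ ^ 2) • (2 • innerSL ℝ z)) z :=
    ((hb (‖z‖ ^ 2)).hasDerivAt).comp_hasFDerivAt z h1
  rw [h2.fderiv]
  simp [inner_rotVec]

/-- The angular derivative of the coordinate `z⁰` is `−z¹`. -/
theorem angDeriv_coord_zero (z : E4) : angDeriv (fun z : E4 => z 0) z = -z 1 := by
  unfold angDeriv
  have h : (fun z : E4 => z 0) = fun z => (EuclideanSpace.proj (0 : Fin 4) : E4 →L[ℝ] ℝ) z := by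
    funext z; rfl
  rw [h, ContinuousLinearMap.fderiv]
  exact rotVec_apply_zero z

/-- Leibniz rule for the angular derivative. -/
theorem angDeriv_mul (f g : E4 → ℝ) (z : E4) (hf : DifferentiableAt ℝ f z) (hg : DifferentiableAt ℝ g z) :
    angDeriv (fun z => f z * g z) z = f z * angDeriv g z + g z * angDeriv f z := by
  unfold angDeriv
  rw [show (fun z => f z * g z) = f * g from rfl, (hf.hasFDerivAt.mul hg.hasFDerivAt).fderiv]
  simp [smul_eq_mul]

/-! ## §2 The profile `h = ∂_θ g` and the test functions -/

/-- A smooth bump on `ℝ`, `≡ 1` on `[-1, 1]`, supported in `(-2, 2)`. -/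
def eta : ContDiffBump (0 : ℝ) := ⟨1, 2, one_pos, one_lt_two⟩

/-- `g(z) = η(‖z‖²) z⁰` — a smooth compactly supported function whose angular derivative does not vanish near the origin. -/
def gFun (z : E4) : ℝ := eta (‖z‖ ^ 2) * z 0

/-- `h = ∂_θ g`, explicitly `h(z) = −η(‖z‖²) z¹`: the (non rotation-invariant) profile of the witness weights. -/
def hFun (z : E4) : ℝ := -(eta (‖z‖ ^ 2) * z 1)

/-- Smoothness of `z ↦ b(‖z‖²)` for a bump `b`. -/
theorem contDiff_bump_norm_sq {c : ℝ} (b : ContDiffBump c) : ContDiff ℝ ∞ (fun z : E4 => b (‖z‖ ^ 2)) :=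
  b.contDiff.comp (contDiff_norm_sq ℝ)

/-- Smoothness of a coordinate. -/
theorem contDiff_coord (i : Fin 4) : ContDiff ℝ ∞ (fun z : E4 => z i) :=
  (EuclideanSpace.proj (i : Fin 4) : E4 →L[ℝ] ℝ).contDiff

/-- `∂_θ g = h`. -/
theorem angDeriv_gFun (z : E4) : angDeriv gFun z = hFun z := by
  have h1 : DifferentiableAt ℝ (fun z : E4 => eta (‖z‖ ^ 2)) z :=
    ((contDiff_bump_norm_sq eta).differentiable (by simp)).differentiableAt
  have h2 : DifferentiableAt ℝ (fun z : E4 => z 0) z := ((contDiff_coord 0).differentiable (by simp)).differentiableAt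
  unfold gFun hFun
  rw [angDeriv_mul _ _ z h1 h2, angDeriv_coord_zero,
    angDeriv_radial eta ((eta.contDiff (n := ⊤)).differentiable (by simp)) z]
  ring

/-- `h` is continuous. -/
theorem continuous_hFun : Continuous hFun :=
  ((contDiff_bump_norm_sq eta).continuous.mul (contDiff_coord 1).continuous).neg

/-- `h` vanishes outside the ball of radius `2` (indeed where `‖z‖² ≥ 2`). -/
theorem hFun_eq_zero {z : E4} (hz : 2 ≤ ‖z‖ ^ 2) : hFun z = 0 := by
  unfold hFun
  rw [ContDiffBump.zero_of_le_dist eta (by simpa [eta, Real.dist_eq] using hz)]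
  simp

/-- `|h| ≤ 2` everywhere. -/
theorem abs_hFun_le (z : E4) : |hFun z| ≤ 2 := by
  by_cases hz : 2 ≤ ‖z‖ ^ 2
  · rw [hFun_eq_zero hz, abs_zero]; norm_num
  · push Not at hz
    have h1 : |eta (‖z‖ ^ 2)| ≤ 1 := by
      rw [abs_of_nonneg (eta.nonneg)]; exact eta.le_one
    have h2 : |z 1| ≤ ‖z‖ := by
      have := PiLp.norm_apply_le z 1
      simpa using this
    have h3 : ‖z‖ ≤ 2 := by nlinarith [norm_nonneg z]
    unfold hFun
    rw [abs_neg, abs_mul]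
    calc |eta (‖z‖ ^ 2)| * |z 1| ≤ 1 * 2 := mul_le_mul h1 (h2.trans h3) (abs_nonneg _) zero_le_one
      _ = 2 := by norm_num

/-- `h` is supported in the closed ball of radius `2`. -/
theorem hFun_eq_zero_of_norm {z : E4} (hz : 2 ≤ ‖z‖) : hFun z = 0 :=
  hFun_eq_zero (by nlinarith)

/-- `g` is smooth. -/
theorem contDiff_gFun : ContDiff ℝ ∞ gFun := (contDiff_bump_norm_sq eta).mul (contDiff_coord 0)

/-! ## §3 The test function `F_s(u,v) = g(u−v) χ_s(u−v) ψ(v)` of the germ class at scale `s` -/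

/-- The radial annular cutoff profile at scale `s`: a bump on `ℝ` centred at `s²` with radii `s²/4 < s²/2`. -/
def chiBump (s : ℝ) (hs : 0 < s) : ContDiffBump (s ^ 2 : ℝ) :=
  ⟨s ^ 2 / 4, s ^ 2 / 2, by positivity, by nlinarith [sq_pos_of_pos hs]⟩

/-- `χ_s(z) = bump_s(‖z‖²)`: smooth, rotation invariant, supported in the annulus `s²/2 < ‖z‖² < 3s²/2`, `χ_s = 1` at `‖z‖ = s`. -/
def chiFun (s : ℝ) (hs : 0 < s) (z : E4) : ℝ := chiBump s hs (‖z‖ ^ 2)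

/-- `ψ(v) = η(‖v‖²)`: a radial bump with `ψ(0) = 1`. -/
def psiFun (v : E4) : ℝ := eta (‖v‖ ^ 2)

/-- The one-slot profile `φ_s = g · χ_s`. -/
def phiFun (s : ℝ) (hs : 0 < s) (z : E4) : ℝ := gFun z * chiFun s hs z

/-- The real two-slot test function `f_s(w) = φ_s(w₀ − w₁) ψ(w₁)`. -/
def fFun (s : ℝ) (hs : 0 < s) (w : Fin 2 → E4) : ℝ := phiFun s hs (w 0 - w 1) * psiFun (w 1)

section TestFunction

variable (s : ℝ) (hs : 0 < s)

/-- Where `χ_s` does not vanish: `s²/2 < ‖z‖² < 3 s²/2`. -/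
theorem chiFun_ne_zero {s : ℝ} {hs : 0 < s} {z : E4} (hz : chiFun s hs z ≠ 0) :
    s ^ 2 / 2 < ‖z‖ ^ 2 ∧ ‖z‖ ^ 2 < 3 * s ^ 2 / 2 := by
  have h : ‖z‖ ^ 2 ∈ Function.support (chiBump s hs : ℝ → ℝ) := hz
  rw [ContDiffBump.support_eq, mem_ball, Real.dist_eq, abs_lt] at h
  simp only [chiBump] at h
  constructor <;> linarith [h.1, h.2]

/-- Where `ψ` does not vanish: `‖v‖² < 2`. -/
theorem psiFun_ne_zero {v : E4} (hv : psiFun v ≠ 0) : ‖v‖ ^ 2 < 2 := by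
  have h : ‖v‖ ^ 2 ∈ Function.support (eta : ℝ → ℝ) := hv
  rw [ContDiffBump.support_eq, mem_ball, Real.dist_eq, abs_lt] at h
  simp only [eta] at h
  linarith [h.1, h.2]

/-- `χ_s(z) = 1` when `‖z‖ = s`. -/
theorem chiFun_eq_one {s : ℝ} {hs : 0 < s} {z : E4} (hz : ‖z‖ = s) : chiFun s hs z = 1 := by
  unfold chiFun
  refine ContDiffBump.one_of_mem_closedBall _ ?_
  rw [mem_closedBall, hz, dist_self]
  simp only [chiBump]
  positivity

/-- `ψ(0) = 1`. -/
theorem psiFun_zero : psiFun 0 = 1 := by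
  unfold psiFun
  refine ContDiffBump.one_of_mem_closedBall _ ?_
  simp [eta]

/-- Smoothness of the pieces. -/
theorem contDiff_phiFun : ContDiff ℝ ∞ (phiFun s hs) := contDiff_gFun.mul (contDiff_bump_norm_sq (chiBump s hs))

/-- Smoothness of `ψ`. -/
theorem contDiff_psiFun : ContDiff ℝ ∞ psiFun := contDiff_bump_norm_sq eta

/-- Smoothness of `f_s`. -/
theorem contDiff_fFun : ContDiff ℝ ∞ (fFun s hs) := by
  have hP : ContDiff ℝ ∞ (fun w : Fin 2 → E4 => w 0 - w 1) := (contDiff_apply ℝ E4 (0 : Fin 2)).sub (contDiff_apply ℝ E4 1)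
  have hQ : ContDiff ℝ ∞ (fun w : Fin 2 → E4 => w 1) := contDiff_apply ℝ E4 1
  exact ((contDiff_phiFun s hs).comp hP).mul (contDiff_psiFun.comp hQ)

/-- Where `f_s` does not vanish. -/
theorem fFun_ne_zero {s : ℝ} {hs : 0 < s} {w : Fin 2 → E4} (hw : fFun s hs w ≠ 0) :
    (s ^ 2 / 2 < ‖w 0 - w 1‖ ^ 2 ∧ ‖w 0 - w 1‖ ^ 2 < 3 * s ^ 2 / 2) ∧ ‖w 1‖ ^ 2 < 2 := by
  unfold fFun phiFun at hw
  exact ⟨chiFun_ne_zero (right_ne_zero_of_mul (left_ne_zero_of_mul hw)), psiFun_ne_zero (right_ne_zero_of_mul hw)⟩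

/-- For `s ≤ 1`, `f_s` is supported in the closed ball of radius `4` of `(ℝ⁴)²`. -/
theorem fFun_eq_zero_of_norm {s : ℝ} {hs : 0 < s} (hs1 : s ≤ 1) {w : Fin 2 → E4} (hw : 4 < ‖w‖) : fFun s hs w = 0 := by
  by_contra hne
  obtain ⟨⟨-, h1⟩, h2⟩ := fFun_ne_zero hne
  have h3 : ‖w 0 - w 1‖ < 2 := by nlinarith [norm_nonneg (w 0 - w 1)]
  have h4 : ‖w 1‖ < 2 := by nlinarith [norm_nonneg (w 1)]
  have h5 : ‖w 0‖ < 4 := by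
    have := norm_le_norm_add_norm_sub' (w 0) (w 1)
    have := norm_sub_rev (w 0) (w 1)
    calc ‖w 0‖ = ‖(w 0 - w 1) + w 1‖ := by rw [sub_add_cancel]
      _ ≤ ‖w 0 - w 1‖ + ‖w 1‖ := norm_add_le _ _
      _ < 4 := by linarith
  have h6 : ‖w‖ ≤ 4 := by
    refine (pi_norm_le_iff_of_nonneg (by norm_num)).2 fun i => ?_
    fin_cases i
    · exact h5.le
    · exact (h4.trans (by norm_num)).le
  linarith

/-- Compact support of the complexified `f_s` (`s ≤ 1`). -/
theorem hasCompactSupport_fFun {s : ℝ} (hs : 0 < s) (hs1 : s ≤ 1) :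
    HasCompactSupport (fun w : Fin 2 → E4 => ((fFun s hs w : ℝ) : ℂ)) := by
  refine HasCompactSupport.intro (isCompact_closedBall (0 : Fin 2 → E4) 4) fun w hw => ?_
  rw [mem_closedBall, dist_zero_right, not_le] at hw
  rw [fFun_eq_zero_of_norm hs1 hw, Complex.ofReal_zero]

/-- **The test function `F_s ∈ 𝓢((ℝ⁴)², ℂ)`** (smooth, compactly supported). -/
def FTest (s : ℝ) (hs : 0 < s) (hs1 : s ≤ 1) : 𝓢((Fin 2 → E4), ℂ) :=
  (hasCompactSupport_fFun hs hs1).toSchwartzMap (Complex.ofRealCLM.contDiff.comp (contDiff_fFun s hs))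

/-- Pointwise values of `F_s`. -/
theorem FTest_apply (hs1 : s ≤ 1) (w : Fin 2 → E4) : FTest s hs hs1 w = ((fFun s hs w : ℝ) : ℂ) := rfl

/-- The support of `F_s` sits in the closed annulus `s²/2 ≤ ‖w₀ − w₁‖² ≤ 3s²/2`. -/
theorem tsupport_FTest_subset (hs1 : s ≤ 1) :
    tsupport (FTest s hs hs1 : (Fin 2 → E4) → ℂ) ⊆
      {w | s ^ 2 / 2 ≤ ‖w 0 - w 1‖ ^ 2 ∧ ‖w 0 - w 1‖ ^ 2 ≤ 3 * s ^ 2 / 2} := by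
  have hcl : IsClosed {w : Fin 2 → E4 | s ^ 2 / 2 ≤ ‖w 0 - w 1‖ ^ 2 ∧ ‖w 0 - w 1‖ ^ 2 ≤ 3 * s ^ 2 / 2} := by
    have hc : Continuous fun w : Fin 2 → E4 => ‖w 0 - w 1‖ ^ 2 :=
      ((continuous_apply 0).sub (continuous_apply 1)).norm.pow 2
    exact (isClosed_le continuous_const hc).inter (isClosed_le hc continuous_const)
  refine closure_minimal (fun w hw => ?_) hcl
  have hw' : fFun s hs w ≠ 0 := by
    intro h0; apply hw; show FTest s hs hs1 w = 0; rw [FTest_apply, h0, Complex.ofReal_zero]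
  obtain ⟨⟨h1, h2⟩, -⟩ := fFun_ne_zero hw'
  exact ⟨h1.le, h2.le⟩

/-- **`F_s` lies in King's class** `KingClass 2 r₀` whenever `2s < r₀` (separation `s/2`, diameter `< 2s`). -/
theorem FTest_mem_kingClass (hs1 : s ≤ 1) {r₀ : ℝ} (hr : 2 * s < r₀) : FTest s hs hs1 ∈ KingClass 2 r₀ := by
  have hsupp := tsupport_FTest_subset s hs hs1
  have hsep : tsupport (FTest s hs hs1 : (Fin 2 → E4) → ℂ) ⊆ Separated 2 (s / 2) := by
    intro w hw i j hij
    obtain ⟨h1, -⟩ := hsupp hw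
    have hz : s / 2 ≤ ‖w 0 - w 1‖ := by nlinarith [norm_nonneg (w 0 - w 1)]
    fin_cases i <;> fin_cases j
    · exact absurd rfl hij
    · simpa [dist_eq_norm] using hz
    · simpa [dist_eq_norm, norm_sub_rev] using hz
    · exact absurd rfl hij
  refine ⟨?_, (hasCompactSupport_fFun hs hs1), ⟨s / 2, by positivity, hsep⟩, ?_⟩
  · exact Summit.QuantumFields.YangMills.Cruxes.OSLegsAtWeakCouplingC.Sketch.GermWard.isOffDiagonal_of_tsupport_subset_separated
      (by positivity) hsep
  · intro w hw i j
    obtain ⟨-, h2⟩ := hsupp hw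
    have hz : ‖w 0 - w 1‖ < 2 * s := by nlinarith [norm_nonneg (w 0 - w 1)]
    have hr0 : 0 < r₀ := by linarith
    fin_cases i <;> fin_cases j
    · simpa using hr0
    · simp [dist_eq_norm]; linarith
    · simp [dist_eq_norm, norm_sub_rev]; linarith
    · simpa using hr0


end TestFunction

end Summit.QuantumFields.YangMills.Theorems.ROT.Ward

end
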